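import Literature.Probability.LatticeModels.GinibreModel
import Literature.Probability.LatticeModels.DisorderedXYModel
import HarnessLib

/-!
# The quartic single-site field on the torus `U(1)^V` and its Laplace limit onto the quarter-turn (`ℤ₄` clock) configurations

Topic `Literature/Probability/LatticeModels`. Analytic half of the proof of Aizenman–Simon's comparison "plane rotor at `2β`
≤ Ising at `β`" (M. Aizenman, B. Simon, Phys. Lett. **76A** (1980) 281 [AizenmanSimon1980RotorIsing]; the comparison itself is
`PlaneRotatorIsingComparisonProof.lean`): Aizenman–Simon add the single-site field `λ ∑_x cos 4θ_x` to the rotor Hamiltonian and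
let `λ → ∞`, which "freezes" every angle onto the four quarter turns `{0, π/2, π, 3π/2}` — the `ℤ₄` clock model. This file supplies,
in the tree's torus vocabulary (`torusHaar`, `reChar` of `DisorderedXYModel` / `GinibreModel`):

* `quarterTurn j = i^j ∈ U(1)` (`j : Fin 4`), `pow_four_eq_one_iff` (`u⁴ = 1 ↔ u ∈ {1, i, −1, −i}`), the quarter-turn configurations
  `quarterCfg k` (`k : V → Fin 4`);
* the quartic characters `quarticChar x : θ ↦ θ_x⁴` of `U(1)^V` and the field `quarticField θ = ∑_x Re(θ_x⁴)`, with `Φ ≤ |V|` and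
  equality EXACTLY at the quarter-turn configurations (`eq_quarterCfg_of_quarticField_eq`), invariance `Φ(θ·ζ) = Φ(θ)` under
  quarter-turn translates;
* **`tendsto_laplace_quarticField`** — the Laplace limit: for every continuous `G` on `U(1)^V`,
  `∫ G e^{λΦ} dθ / ∫ e^{λΦ} dθ → 4^{−|V|} ∑_{k : V → ℤ/4} G(i^k)` as `λ → ∞`.
  Proof (elementary, no weak-convergence machinery): the tilted Haar measures give mass `≤ e^{−λη/2}/μ(W)` to the complement of small
  neighbourhoods `U_k = ζ_k·U₁` of the maximisers (compactness gives the gap `η`; open sets have positive Haar measure), the `4^{|V|}`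
  neighbourhoods carry EQUAL tilted mass (translation invariance of Haar measure and of `Φ`), and `G` varies by `< ε` on each.

Everything here is PROVED (standard axioms); no named facts. Written for the hubbard-tc cell (MO-S3, seat p1, 2026-08-27) to
discharge the named fact `PlaneRotator.AizenmanSimonRotorIsingComparison`.

## References

* M. Aizenman, B. Simon, *A comparison of plane rotor and Ising models*, Phys. Lett. 76A (1980) 281–282, eqs. (4)–(6).
  [AizenmanSimon1980RotorIsing]
* J. Ginibre, Comm. Math. Phys. 16 (1970) 310 (the `cos 4θ` field is a character real part, inside Ginibre's cone). [Ginibre1970]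
-/

noncomputable section

open MeasureTheory Filter Finset
open scoped Topology BigOperators ComplexConjugate

namespace Literature.Probability.LatticeModels

namespace PlaneRotator

/-! ### §0 Quarter turns -/

/-- The four quarter turns `i^j ∈ U(1)`, `j ∈ ℤ/4`. [cite: AizenmanSimon1980RotorIsing, eqs. (4)-(6)] -/
def quarterTurn (j : Fin 4) : Circle :=
  ⟨Complex.I ^ (j : ℕ), by simp [Submonoid.unitSphere, Complex.norm_I]⟩

/-- `quarterTurn j = i^j` as a complex number. [cite: AizenmanSimon1980RotorIsing, eqs. (4)-(6)] -/
@[simp] theorem coe_quarterTurn (j : Fin 4) : (quarterTurn j : ℂ) = Complex.I ^ (j : ℕ) := rfl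

/-- `(i^j)^4 = 1`. [cite: AizenmanSimon1980RotorIsing, eqs. (4)-(6)] -/
theorem quarterTurn_pow_four (j : Fin 4) : (quarterTurn j : ℂ) ^ 4 = 1 := by
  rw [coe_quarterTurn, ← pow_mul, mul_comm, pow_mul, Complex.I_pow_four, one_pow]

/-- `u⁴ = 1` in `ℂ` iff `u` is a quarter turn. [cite: AizenmanSimon1980RotorIsing, eqs. (4)-(6)] -/
theorem pow_four_eq_one_iff (u : ℂ) :
    u ^ 4 = 1 ↔ u = 1 ∨ u = Complex.I ∨ u = -1 ∨ u = -Complex.I := by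
  constructor
  · intro h
    have hfac : (u - 1) * (u + 1) * ((u - Complex.I) * (u + Complex.I)) = 0 := by
      have hI : Complex.I ^ 2 = -1 := Complex.I_sq
      linear_combination h + (1 - u ^ 2) * hI
    rcases mul_eq_zero.1 hfac with h1 | h2
    · rcases mul_eq_zero.1 h1 with h | h
      · exact Or.inl (sub_eq_zero.1 h)
      · exact Or.inr (Or.inr (Or.inl (eq_neg_of_add_eq_zero_left h)))
    · rcases mul_eq_zero.1 h2 with h | h
      · exact Or.inr (Or.inl (sub_eq_zero.1 h))
      · exact Or.inr (Or.inr (Or.inr (eq_neg_of_add_eq_zero_left h)))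
  · rintro (rfl | rfl | rfl | rfl)
    · simp
    · exact Complex.I_pow_four
    · norm_num
    · rw [neg_pow, Complex.I_pow_four]; norm_num

/-- Every quarter turn of `ℂ` is `quarterTurn j` for some `j`. [cite: AizenmanSimon1980RotorIsing, eqs. (4)-(6)] -/
theorem exists_quarterTurn_of_pow_four_eq_one {u : Circle} (h : (u : ℂ) ^ 4 = 1) :
    ∃ j : Fin 4, u = quarterTurn j := by
  rcases (pow_four_eq_one_iff _).1 h with h | h | h | h
  · exact ⟨0, Circle.ext <| by simp [h]⟩
  · exact ⟨1, Circle.ext <| by simp [h]⟩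
  · exact ⟨2, Circle.ext <| by simp [h]⟩
  · exact ⟨3, Circle.ext <| by rw [coe_quarterTurn, h]; norm_num [pow_succ]⟩

/-- For a unit complex number, `Re(u⁴) ≤ 1`. [cite: AizenmanSimon1980RotorIsing, eqs. (4)-(6)] -/
theorem re_pow_four_le_one (u : Circle) : ((u : ℂ) ^ 4).re ≤ 1 := by
  refine (Complex.re_le_norm _).trans ?_
  rw [norm_pow, Circle.norm_coe, one_pow]

/-- For a unit complex number, `Re(u⁴) = 1` forces `u⁴ = 1`. [cite: AizenmanSimon1980RotorIsing, eqs. (4)-(6)] -/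
theorem pow_four_eq_one_of_re_eq_one {u : Circle} (h : ((u : ℂ) ^ 4).re = 1) : (u : ℂ) ^ 4 = 1 := by
  set z : ℂ := (u : ℂ) ^ 4 with hz
  have hn : ‖z‖ = 1 := by rw [hz, norm_pow, Circle.norm_coe, one_pow]
  have h2 : z.re * z.re + z.im * z.im = 1 := by
    have h' := Complex.normSq_eq_norm_sq z
    rw [hn, Complex.normSq_apply] at h'
    linarith
  have him : z.im = 0 := by
    rw [h] at h2
    nlinarith
  exact Complex.ext (by simpa using h) (by simpa using him)

/-! ### §1 The quartic single-site characters and the field `Φ = ∑_x cos 4θ_x` -/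

section Quartic

variable {V : Type*} [Fintype V]

/-- The quartic single-site character `θ ↦ θ_x⁴` of the torus `U(1)^V` (its real part is the Aizenman–Simon symmetry-breaking
field `cos 4θ_x`). [cite: AizenmanSimon1980RotorIsing, eq. (4)] -/
def quarticChar (x : V) : (V → Circle) →ₜ* Circle where
  toFun θ := θ x ^ 4
  map_one' := by simp
  map_mul' θ θ' := by simp [mul_pow]
  continuous_toFun := (continuous_apply x).pow 4

omit [Fintype V] in
/-- `χ_x(θ) = θ_x⁴` as a complex number. [cite: AizenmanSimon1980RotorIsing, eqs. (4)-(6)] -/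
@[simp] theorem coe_quarticChar_apply (x : V) (θ : V → Circle) :
    ((quarticChar x θ : Circle) : ℂ) = (θ x : ℂ) ^ 4 :=
  map_pow Circle.coeHom (θ x) 4

/-- The total quartic field `Φ(θ) = ∑_x Re(θ_x⁴) = ∑_x cos 4θ_x`. [cite: AizenmanSimon1980RotorIsing, eq. (4)] -/
def quarticField (θ : V → Circle) : ℝ :=
  ∑ x, reChar (quarticChar x) θ

/-- `Φ(θ) = ∑_x Re(θ_x⁴)`. [cite: AizenmanSimon1980RotorIsing, eqs. (4)-(6)] -/
theorem quarticField_eq (θ : V → Circle) : quarticField θ = ∑ x, ((θ x : ℂ) ^ 4).re := by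
  simp [quarticField, reChar]

/-- `Φ` is continuous. [cite: AizenmanSimon1980RotorIsing, eqs. (4)-(6)] -/
theorem continuous_quarticField : Continuous (quarticField : (V → Circle) → ℝ) :=
  continuous_finsetSum _ fun x _ => continuous_reChar (quarticChar x)

/-- `Φ ≤ |V|`. [cite: AizenmanSimon1980RotorIsing, eqs. (4)-(6)] -/
theorem quarticField_le (θ : V → Circle) : quarticField θ ≤ Fintype.card V := by
  rw [quarticField_eq]
  calc ∑ x, ((θ x : ℂ) ^ 4).re ≤ ∑ _x : V, (1 : ℝ) := Finset.sum_le_sum fun x _ => re_pow_four_le_one (θ x)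
    _ = Fintype.card V := by simp

/-- `Φ(θ) = |V|` forces every `θ_x` to be a quarter turn. [cite: AizenmanSimon1980RotorIsing, eqs. (4)-(6)] -/
theorem forall_pow_four_eq_one_of_quarticField_eq {θ : V → Circle} (h : quarticField θ = Fintype.card V) (x : V) :
    (θ x : ℂ) ^ 4 = 1 := by
  rw [quarticField_eq] at h
  have hle : ∀ y ∈ (Finset.univ : Finset V), ((θ y : ℂ) ^ 4).re ≤ 1 := fun y _ => re_pow_four_le_one (θ y)
  have heq := (Finset.sum_eq_sum_iff_of_le hle).1 (by rw [h]; simp)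
  exact pow_four_eq_one_of_re_eq_one (heq x (Finset.mem_univ x))

end Quartic

/-! ### §2 The quarter-turn configurations and the Laplace limit `λ → ∞` -/

section Laplace

variable {V : Type*} [Fintype V]

/-- The quarter-turn configurations `θ_x = i^{k_x}`, `k : V → ℤ/4` — the support of the `λ → ∞` limit of the quartic field
(the `ℤ₄` clock configurations). [cite: AizenmanSimon1980RotorIsing, eq. (6)] -/
def quarterCfg (k : V → Fin 4) : V → Circle := fun x => quarterTurn (k x)

omit [Fintype V] in
/-- Unfolding of `quarterCfg`. [cite: AizenmanSimon1980RotorIsing, eqs. (4)-(6)] -/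
@[simp] theorem quarterCfg_apply (k : V → Fin 4) (x : V) : quarterCfg k x = quarterTurn (k x) := rfl

omit [Fintype V] in
/-- `(ζ_x)⁴ = 1` for a quarter-turn configuration. [cite: AizenmanSimon1980RotorIsing, eqs. (4)-(6)] -/
theorem coe_quarterCfg_pow_four (k : V → Fin 4) (x : V) : ((quarterCfg k x : Circle) : ℂ) ^ 4 = 1 :=
  quarterTurn_pow_four (k x)

/-- The quartic field is invariant under multiplication by a quarter-turn configuration. [cite: AizenmanSimon1980RotorIsing, eqs. (4)-(6)] -/
theorem quarticField_mul_quarterCfg (θ : V → Circle) (k : V → Fin 4) :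
    quarticField (θ * quarterCfg k) = quarticField θ := by
  rw [quarticField_eq, quarticField_eq]
  refine Finset.sum_congr rfl fun x _ => ?_
  rw [Pi.mul_apply, Circle.coe_mul, mul_pow, coe_quarterCfg_pow_four, mul_one]

/-- The quartic field attains `|V|` at every quarter-turn configuration. [cite: AizenmanSimon1980RotorIsing, eqs. (4)-(6)] -/
theorem quarticField_quarterCfg (k : V → Fin 4) : quarticField (quarterCfg k) = Fintype.card V := by
  rw [quarticField_eq]
  simp_rw [coe_quarterCfg_pow_four, Complex.one_re]
  simp

/-- `Φ(θ) = |V|` only at quarter-turn configurations. [cite: AizenmanSimon1980RotorIsing, eqs. (4)-(6)] -/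
theorem eq_quarterCfg_of_quarticField_eq {θ : V → Circle} (h : quarticField θ = Fintype.card V) :
    ∃ k : V → Fin 4, θ = quarterCfg k := by
  have hx := forall_pow_four_eq_one_of_quarticField_eq h
  choose k hk using fun x => exists_quarterTurn_of_pow_four_eq_one (hx x)
  exact ⟨k, funext hk⟩

/-- A complex number with a coordinate of modulus `≥ 1` has norm `≥ 1`. [folklore] -/
private theorem one_le_norm_of_re_im (z : ℂ) (h : 1 ≤ |z.re| ∨ 1 ≤ |z.im|) : 1 ≤ ‖z‖ := by
  rcases h with h | h
  · exact h.trans (Complex.abs_re_le_norm z)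
  · exact h.trans (Complex.abs_im_le_norm z)

/-- Distinct quarter turns are at distance `≥ 1` (in fact `≥ √2`). [cite: AizenmanSimon1980RotorIsing, eqs. (4)-(6)] -/
theorem one_le_norm_quarterTurn_sub {j j' : Fin 4} (h : j ≠ j') :
    1 ≤ ‖(quarterTurn j : ℂ) - quarterTurn j'‖ := by
  apply one_le_norm_of_re_im
  fin_cases j <;> fin_cases j' <;> first | exact absurd rfl h | (simp [pow_succ]; try norm_num)

/-- `‖u ζ⁻¹ − 1‖ = ‖u − ζ‖` on the unit circle. [folklore] -/
private theorem norm_coe_mul_inv_sub_one (u ζ : Circle) :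
    ‖((u * ζ⁻¹ : Circle) : ℂ) - 1‖ = ‖(u : ℂ) - ζ‖ := by
  have hζ : (ζ : ℂ) ≠ 0 := Circle.coe_ne_zero ζ
  have e : ((u * ζ⁻¹ : Circle) : ℂ) - 1 = ((u : ℂ) - ζ) * (ζ : ℂ)⁻¹ := by
    rw [Circle.coe_mul, Circle.coe_inv, sub_mul, mul_inv_cancel₀ hζ]
  rw [e, norm_mul, norm_inv, Circle.norm_coe, inv_one, mul_one]

/-- The neighbourhood of `1` used in the Laplace argument: sitewise within `1/2` of `1`, and `G` varies by less than `ε` on each of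
its quarter-turn translates. [folklore] -/
private theorem exists_laplace_nhds {G : (V → Circle) → ℝ} (hG : Continuous G) {ε : ℝ} (hε : 0 < ε) :
    ∃ U₁ : Set (V → Circle), IsOpen U₁ ∧ (1 : V → Circle) ∈ U₁ ∧
      (∀ θ ∈ U₁, ∀ x, ‖(θ x : ℂ) - 1‖ < 1 / 2) ∧
      (∀ θ ∈ U₁, ∀ k : V → Fin 4, |G (θ * quarterCfg k) - G (quarterCfg k)| < ε) := by
  refine ⟨(⋂ x : V, {θ | ‖(θ x : ℂ) - 1‖ < 1 / 2}) ∩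
      ⋂ k : V → Fin 4, {θ | |G (θ * quarterCfg k) - G (quarterCfg k)| < ε}, ?_, ?_, ?_, ?_⟩
  · refine IsOpen.inter (isOpen_iInter_of_finite fun x => ?_) (isOpen_iInter_of_finite fun k => ?_)
    · exact isOpen_lt ((continuous_subtype_val.comp (continuous_apply x)).sub continuous_const).norm
        continuous_const
    · exact isOpen_lt (((hG.comp (continuous_id.mul continuous_const)).sub continuous_const).abs)
        continuous_const
  · refine ⟨Set.mem_iInter.2 fun x => ?_, Set.mem_iInter.2 fun k => ?_⟩
    · simp
    · simp [hε]
  · exact fun θ hθ x => Set.mem_iInter.1 hθ.1 x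
  · exact fun θ hθ k => Set.mem_iInter.1 hθ.2 k

variable [DecidableEq V] [MeasurableSpace Circle] [BorelSpace Circle]

/-- **Laplace limit of the quartic field.** For every continuous `G` on the torus `U(1)^V`,
`∫ G e^{λΦ} dθ / ∫ e^{λΦ} dθ → 4^{−|V|} ∑_{k : V → ℤ/4} G(i^k)` as `λ → ∞`: the tilted Haar measures concentrate, with equal weights
(translation invariance of Haar measure and of `Φ` under the quarter-turn subgroup), on the `4^{|V|}` maximisers of `Φ`.
[cite: AizenmanSimon1980RotorIsing, eqs. (5)-(6)] -/
theorem tendsto_laplace_quarticField (G : (V → Circle) → ℝ) (hG : Continuous G) :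
    Tendsto (fun lam : ℝ => (∫ θ, G θ * Real.exp (lam * quarticField θ) ∂torusHaar V) /
        ∫ θ, Real.exp (lam * quarticField θ) ∂torusHaar V) atTop
      (𝓝 ((∑ k : V → Fin 4, G (quarterCfg k)) / Fintype.card (V → Fin 4))) := by
  classical
  set μ := torusHaar V with hμ
  set n : ℝ := (Fintype.card V : ℝ) with hn
  set N : ℝ := (Fintype.card (V → Fin 4) : ℝ) with hN
  set avg : ℝ := (∑ k : V → Fin 4, G (quarterCfg k)) / N with havg
  have hNpos : 0 < N := by rw [hN]; exact_mod_cast Fintype.card_pos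
  have havgN : avg * N = ∑ k : V → Fin 4, G (quarterCfg k) := div_mul_cancel₀ _ hNpos.ne'
  -- a bound on `G`
  obtain ⟨C, hC⟩ := isCompact_univ.exists_bound_of_continuousOn hG.continuousOn
  have hC' : ∀ θ, |G θ| ≤ C := fun θ => by simpa [Real.norm_eq_abs] using hC θ (Set.mem_univ θ)
  have hC0 : 0 ≤ C := (abs_nonneg _).trans (hC' 1)
  rw [Metric.tendsto_atTop]
  intro ε hε
  -- the neighbourhoods `U k` of the quarter-turn configurations
  obtain ⟨U₁, hU₁o, h1U₁, hU₁half, hU₁G⟩ := exists_laplace_nhds hG (half_pos hε)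
  set ζ : (V → Fin 4) → V → Circle := quarterCfg with hζ
  let U : (V → Fin 4) → Set (V → Circle) := fun k => (fun θ => θ * (ζ k)⁻¹) ⁻¹' U₁
  have hUo : ∀ k, IsOpen (U k) := fun k => hU₁o.preimage (continuous_id.mul continuous_const)
  have hUmem : ∀ k θ, θ ∈ U k ↔ θ * (ζ k)⁻¹ ∈ U₁ := fun k θ => Iff.rfl
  have hζU : ∀ k, ζ k ∈ U k := fun k => by rw [hUmem, mul_inv_cancel]; exact h1U₁
  have hUG : ∀ k, ∀ θ ∈ U k, |G θ - G (ζ k)| < ε / 2 := fun k θ hθ => by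
    have h := hU₁G _ ((hUmem k θ).1 hθ) k
    rwa [inv_mul_cancel_right] at h
  have hUdisj : Pairwise fun k k' => Disjoint (U k) (U k') := by
    intro k k' hkk'
    rw [Set.disjoint_left]
    intro θ hθ hθ'
    apply hkk'
    funext x
    by_contra hx
    have h1 : ‖(θ x : ℂ) - ζ k x‖ < 1 / 2 := by
      have h := hU₁half _ ((hUmem k θ).1 hθ) x
      rwa [Pi.mul_apply, Pi.inv_apply, norm_coe_mul_inv_sub_one] at h
    have h2 : ‖(θ x : ℂ) - ζ k' x‖ < 1 / 2 := by
      have h := hU₁half _ ((hUmem k' θ).1 hθ') x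
      rwa [Pi.mul_apply, Pi.inv_apply, norm_coe_mul_inv_sub_one] at h
    have h3 : 1 ≤ ‖(ζ k x : ℂ) - ζ k' x‖ := one_le_norm_quarterTurn_sub hx
    have h4 : ‖(ζ k x : ℂ) - ζ k' x‖ < 1 :=
      calc ‖(ζ k x : ℂ) - ζ k' x‖ ≤ ‖(ζ k x : ℂ) - θ x‖ + ‖(θ x : ℂ) - ζ k' x‖ := norm_sub_le_norm_sub_add_norm_sub _ _ _
        _ < 1 / 2 + 1 / 2 := add_lt_add (by rw [norm_sub_rev]; exact h1) h2
        _ = 1 := by norm_num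
    linarith
  -- the complement `K` and the gap `η`
  set K : Set (V → Circle) := (⋃ k, U k)ᶜ with hK
  have hKc : IsClosed K := (isOpen_iUnion hUo).isClosed_compl
  obtain ⟨η, hη, hKη⟩ : ∃ η : ℝ, 0 < η ∧ ∀ θ ∈ K, quarticField θ ≤ n - η := by
    rcases K.eq_empty_or_nonempty with hKe | hKne
    · exact ⟨1, one_pos, fun θ hθ => by rw [hKe] at hθ; exact absurd hθ (Set.notMem_empty θ)⟩
    · obtain ⟨θ₀, hθ₀K, hmax⟩ := hKc.isCompact.exists_isMaxOn hKne continuous_quarticField.continuousOn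
      have hlt : quarticField θ₀ < n := by
        refine lt_of_le_of_ne (quarticField_le θ₀) fun heq => ?_
        obtain ⟨k, hk⟩ := eq_quarterCfg_of_quarticField_eq heq
        exact hθ₀K (Set.mem_iUnion.2 ⟨k, hk ▸ hζU k⟩)
      exact ⟨n - quarticField θ₀, sub_pos.2 hlt, fun θ hθ => by linarith [isMaxOn_iff.1 hmax θ hθ]⟩
  -- the lower window `W` around the maximisers
  set W : Set (V → Circle) := {θ | n - η / 2 < quarticField θ} with hW
  have hWo : IsOpen W := isOpen_lt continuous_const continuous_quarticField
  have h1W : (1 : V → Circle) ∈ W := by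
    show n - η / 2 < quarticField 1
    have h : quarticField (1 : V → Circle) = n := by
      have := quarticField_quarterCfg (V := V) (fun _ => 0)
      rwa [show quarterCfg (fun _ : V => (0 : Fin 4)) = 1 from funext fun x => Circle.ext (by simp)] at this
    rw [h]; linarith
  have hp : 0 < μ.real W := by
    rw [measureReal_def]
    exact ENNReal.toReal_pos (hWo.measure_pos μ ⟨1, h1W⟩).ne' (measure_ne_top μ W)
  -- the threshold `Λ`
  have hdecay : Tendsto (fun t : ℝ => (C + |avg|) * Real.exp (-(t * (η / 2))) / μ.real W) atTop (𝓝 0) := by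
    have h := ((Real.tendsto_exp_neg_atTop_nhds_zero.comp (tendsto_id.atTop_mul_const (half_pos hη))).const_mul
      (C + |avg|)).div_const (μ.real W)
    simpa using h
  obtain ⟨Λ, hΛ⟩ := Filter.eventually_atTop.1
    ((hdecay.eventually (gt_mem_nhds (half_pos hε))).and (Filter.eventually_ge_atTop 0))
  refine ⟨Λ, fun lam hlam => ?_⟩
  obtain ⟨hsmall, hlam0⟩ := hΛ lam hlam
  -- the tilted integrals at this `λ`
  set E : (V → Circle) → ℝ := fun θ => Real.exp (lam * quarticField θ) with hE
  have hEc : Continuous E := Real.continuous_exp.comp (continuous_const.mul continuous_quarticField)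
  have hEpos : ∀ θ, 0 < E θ := fun θ => Real.exp_pos _
  have hEi : Integrable E μ := integrable_torusHaar_of_continuous hEc
  have hGEc : Continuous fun θ => G θ * E θ := hG.mul hEc
  have hGEi : Integrable (fun θ => G θ * E θ) μ := integrable_torusHaar_of_continuous hGEc
  have hEtrans : ∀ k θ, E (θ * ζ k) = E θ := fun k θ => by
    simp only [hE]; rw [quarticField_mul_quarterCfg]
  set Z : ℝ := ∫ θ, E θ ∂μ with hZ
  set A : ℝ := ∫ θ, U₁.indicator E θ ∂μ with hA
  set R₃ : ℝ := ∫ θ, K.indicator E θ ∂μ with hR₃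
  set e : ℝ := Real.exp (lam * (n - η)) with he
  have hUmeas : ∀ k, MeasurableSet (U k) := fun k => (hUo k).measurableSet
  have hKmeas : MeasurableSet K := hKc.measurableSet
  -- translation invariance: every `U k` carries the same tilted mass `A`
  have hUζ : ∀ k θ, θ * ζ k ∈ U k ↔ θ ∈ U₁ := fun k θ => by
    rw [hUmem, mul_inv_cancel_right]
  have h_indE : ∀ k, ∫ θ, (U k).indicator E θ ∂μ = A := by
    intro k
    rw [← integral_torusHaar_mul_right ((U k).indicator E) (ζ k)]
    refine integral_congr_ae (ae_of_all _ fun θ => ?_)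
    show (U k).indicator E (θ * ζ k) = U₁.indicator E θ
    by_cases hθ : θ ∈ U₁
    · rw [Set.indicator_of_mem ((hUζ k θ).2 hθ), Set.indicator_of_mem hθ, hEtrans]
    · rw [Set.indicator_of_notMem (fun h => hθ ((hUζ k θ).1 h)), Set.indicator_of_notMem hθ]
  -- the pointwise partition of unity by the `U k` and `K`
  have hpart : ∀ F : (V → Circle) → ℝ, ∀ θ, F θ = ∑ k, (U k).indicator F θ + K.indicator F θ := by
    intro F θ
    have hdisj : ((Finset.univ : Finset (V → Fin 4)) : Set (V → Fin 4)).PairwiseDisjoint U :=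
      fun k _ k' _ hkk' => hUdisj hkk'
    have h1 := Finset.indicator_biUnion_apply Finset.univ U (f := F) hdisj θ
    have h2 : (⋃ k ∈ (Finset.univ : Finset (V → Fin 4)), U k) = ⋃ k, U k := by simp
    rw [h2] at h1
    rw [← h1, hK]
    exact (congrFun (Set.indicator_self_add_compl (⋃ k, U k) F) θ).symm
  have hsplitE : Z = N * A + R₃ := by
    have hi : ∀ k, Integrable ((U k).indicator E) μ := fun k => hEi.indicator (hUmeas k)
    calc Z = ∫ θ, (∑ k, (U k).indicator E θ + K.indicator E θ) ∂μ := integral_congr_ae (ae_of_all _ (hpart E))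
      _ = ∑ k, ∫ θ, (U k).indicator E θ ∂μ + R₃ := by
          rw [integral_add (integrable_finsetSum _ fun k _ => hi k) (hEi.indicator hKmeas),
            integral_finsetSum _ fun k _ => hi k]
      _ = N * A + R₃ := by simp_rw [h_indE]; rw [Finset.sum_const, Finset.card_univ, nsmul_eq_mul]
  have hsplitG : ∫ θ, G θ * E θ ∂μ =
      ∑ k, ∫ θ, (U k).indicator (fun θ => G θ * E θ) θ ∂μ + ∫ θ, K.indicator (fun θ => G θ * E θ) θ ∂μ := by
    have hi : ∀ k, Integrable ((U k).indicator fun θ => G θ * E θ) μ := fun k => hGEi.indicator (hUmeas k)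
    calc ∫ θ, G θ * E θ ∂μ = ∫ θ, (∑ k, (U k).indicator (fun θ => G θ * E θ) θ +
          K.indicator (fun θ => G θ * E θ) θ) ∂μ := integral_congr_ae (ae_of_all _ (hpart _))
      _ = _ := by
          rw [integral_add (integrable_finsetSum _ fun k _ => hi k) (hGEi.indicator hKmeas),
            integral_finsetSum _ fun k _ => hi k]
  -- estimates
  have hA0 : 0 ≤ A := integral_nonneg fun θ => Set.indicator_nonneg (fun θ _ => (hEpos θ).le) θ
  have hEK : ∀ θ ∈ K, E θ ≤ e := fun θ hθ => by
    simp only [hE, he]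
    exact Real.exp_le_exp.2 (mul_le_mul_of_nonneg_left (hKη θ hθ) hlam0)
  have hR₃0 : 0 ≤ R₃ := integral_nonneg fun θ => Set.indicator_nonneg (fun θ _ => (hEpos θ).le) θ
  have hR₃e : R₃ ≤ e := by
    have h : ∀ θ, K.indicator E θ ≤ e := fun θ => by
      by_cases hθ : θ ∈ K
      · rw [Set.indicator_of_mem hθ]; exact hEK θ hθ
      · rw [Set.indicator_of_notMem hθ]; exact (Real.exp_pos _).le
    calc R₃ ≤ ∫ _θ, e ∂μ := integral_mono (hEi.indicator hKmeas) (integrable_const e) h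
      _ = e := by simp
  have hKG : |∫ θ, K.indicator (fun θ => G θ * E θ) θ ∂μ| ≤ C * e := by
    have h : ∀ θ, ‖K.indicator (fun θ => G θ * E θ) θ‖ ≤ C * e := fun θ => by
      by_cases hθ : θ ∈ K
      · rw [Set.indicator_of_mem hθ, Real.norm_eq_abs, abs_mul, abs_of_pos (hEpos θ)]
        exact mul_le_mul (hC' θ) (hEK θ hθ) (hEpos θ).le hC0
      · rw [Set.indicator_of_notMem hθ, norm_zero]; positivity
    have h' := norm_integral_le_of_norm_le_const (μ := μ) (ae_of_all _ h)
    rwa [probReal_univ, mul_one, Real.norm_eq_abs] at h'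
  have hUkG : ∀ k, |∫ θ, (U k).indicator (fun θ => G θ * E θ) θ ∂μ - G (ζ k) * A| ≤ ε / 2 * A := by
    intro k
    rw [← h_indE k, ← integral_const_mul, ← integral_sub (hGEi.indicator (hUmeas k))
      ((hEi.indicator (hUmeas k)).const_mul _), ← integral_const_mul]
    have h : ∀ θ, ‖(U k).indicator (fun θ => G θ * E θ) θ - G (ζ k) * (U k).indicator E θ‖ ≤
        ε / 2 * (U k).indicator E θ := fun θ => by
      by_cases hθ : θ ∈ U k
      · rw [Set.indicator_of_mem hθ, Set.indicator_of_mem hθ, ← sub_mul, norm_mul, Real.norm_eq_abs,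
          Real.norm_eq_abs, abs_of_pos (hEpos θ)]
        exact mul_le_mul_of_nonneg_right (hUG k θ hθ).le (hEpos θ).le
      · rw [Set.indicator_of_notMem hθ, Set.indicator_of_notMem hθ]; simp
    have h' := norm_integral_le_of_norm_le (((hEi.indicator (hUmeas k)).const_mul (ε / 2))) (ae_of_all _ h)
    rwa [Real.norm_eq_abs] at h'
  have hZlow : Real.exp (lam * (n - η / 2)) * μ.real W ≤ Z := by
    have h : ∀ θ, W.indicator (fun _ => Real.exp (lam * (n - η / 2))) θ ≤ E θ := fun θ => by
      by_cases hθ : θ ∈ W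
      · rw [Set.indicator_of_mem hθ]
        exact Real.exp_le_exp.2 (mul_le_mul_of_nonneg_left (le_of_lt hθ) hlam0)
      · rw [Set.indicator_of_notMem hθ]; exact (hEpos θ).le
    calc Real.exp (lam * (n - η / 2)) * μ.real W
        = ∫ θ, W.indicator (fun _ => Real.exp (lam * (n - η / 2))) θ ∂μ := by
          rw [integral_indicator_const _ hWo.measurableSet, smul_eq_mul, mul_comm]
      _ ≤ Z := integral_mono ((integrable_const _).indicator hWo.measurableSet) hEi h
  have hZpos : 0 < Z := lt_of_lt_of_le (mul_pos (Real.exp_pos _) hp) hZlow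
  have hNA : N * A ≤ Z := by rw [hsplitE]; linarith
  -- assemble
  have hkey : ∫ θ, G θ * E θ ∂μ - avg * Z =
      ∑ k, (∫ θ, (U k).indicator (fun θ => G θ * E θ) θ ∂μ - G (ζ k) * A) +
        ∫ θ, K.indicator (fun θ => G θ * E θ) θ ∂μ - avg * R₃ := by
    rw [hsplitG, hsplitE, Finset.sum_sub_distrib, ← Finset.sum_mul, ← havgN]
    ring
  have hnum : |∫ θ, G θ * E θ ∂μ - avg * Z| ≤ N * (ε / 2 * A) + (C + |avg|) * e := by
    rw [hkey]
    calc |∑ k, (∫ θ, (U k).indicator (fun θ => G θ * E θ) θ ∂μ - G (ζ k) * A) +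
          ∫ θ, K.indicator (fun θ => G θ * E θ) θ ∂μ - avg * R₃|
        ≤ |∑ k, (∫ θ, (U k).indicator (fun θ => G θ * E θ) θ ∂μ - G (ζ k) * A)| +
          |∫ θ, K.indicator (fun θ => G θ * E θ) θ ∂μ| + |avg * R₃| := by
            exact (abs_sub _ _).trans (add_le_add (abs_add_le _ _) le_rfl)
      _ ≤ ∑ k, |∫ θ, (U k).indicator (fun θ => G θ * E θ) θ ∂μ - G (ζ k) * A| + C * e + |avg| * e := by
            refine add_le_add (add_le_add (Finset.abs_sum_le_sum_abs _ _) hKG) ?_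
            rw [abs_mul, abs_of_nonneg hR₃0]
            exact mul_le_mul_of_nonneg_left hR₃e (abs_nonneg _)
      _ ≤ ∑ _k : V → Fin 4, ε / 2 * A + C * e + |avg| * e :=
            add_le_add (add_le_add (Finset.sum_le_sum fun k _ => hUkG k) le_rfl) le_rfl
      _ = N * (ε / 2 * A) + (C + |avg|) * e := by
            rw [Finset.sum_const, Finset.card_univ, nsmul_eq_mul]; ring
  have hratio : |(∫ θ, G θ * E θ ∂μ) / Z - avg| ≤ ε / 2 + (C + |avg|) * e / Z := by
    have hsub : (∫ θ, G θ * E θ ∂μ) / Z - avg = (∫ θ, G θ * E θ ∂μ - avg * Z) / Z := by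
      field_simp
    rw [hsub, abs_div, abs_of_pos hZpos, div_le_iff₀ hZpos]
    calc |∫ θ, G θ * E θ ∂μ - avg * Z| ≤ N * (ε / 2 * A) + (C + |avg|) * e := hnum
      _ = ε / 2 * (N * A) + (C + |avg|) * e := by ring
      _ ≤ ε / 2 * Z + (C + |avg|) * e := by gcongr
      _ = (ε / 2 + (C + |avg|) * e / Z) * Z := by field_simp
  have htail : (C + |avg|) * e / Z ≤ (C + |avg|) * Real.exp (-(lam * (η / 2))) / μ.real W := by
    have hCa : 0 ≤ C + |avg| := add_nonneg hC0 (abs_nonneg _)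
    have hexp : e = Real.exp (-(lam * (η / 2))) * Real.exp (lam * (n - η / 2)) := by
      rw [he, ← Real.exp_add]; ring_nf
    calc (C + |avg|) * e / Z ≤ (C + |avg|) * e / (Real.exp (lam * (n - η / 2)) * μ.real W) :=
          div_le_div_of_nonneg_left (mul_nonneg hCa (Real.exp_pos _).le) (mul_pos (Real.exp_pos _) hp) hZlow
      _ = (C + |avg|) * Real.exp (-(lam * (η / 2))) / μ.real W := by
          rw [hexp]; field_simp
  rw [Real.dist_eq]
  calc |(∫ θ, G θ * E θ ∂μ) / Z - avg| ≤ ε / 2 + (C + |avg|) * e / Z := hratio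
    _ ≤ ε / 2 + (C + |avg|) * Real.exp (-(lam * (η / 2))) / μ.real W := add_le_add le_rfl htail
    _ < ε / 2 + ε / 2 := add_lt_add_of_le_of_lt le_rfl hsmall
    _ = ε := add_halves ε

end Laplace

end PlaneRotator

end Literature.Probability.LatticeModels
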